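import Summits.HubbardSuperconductivity.HubbardSuperconductivity.Theorems.LiebTwinLiebTwinFloor
import Summits.HubbardSuperconductivity.HubbardSuperconductivity.Theorems.LiebTwinNoOnsiteODLROCouplingTransport
import Summits.HubbardSuperconductivity.HubbardSuperconductivity.Theorems.LiebTwinNoOnsiteODLROPencilGainFirstOrder
import Literature.MathematicalPhysics.QuantumLattice.FreeFermiGasNoThermalPairFieldLRO
import HarnessLib

/-!
# Crux `NoOnsiteODLRO` (stmt-HubbardSuperconductivity-0933), line `Sketch` — CALIBRATION of the core stub:
# the crux is EQUIVALENT to the LOCAL reduced-BCS stability; the stub adds only an `L`-uniform channel strength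

Helper file of lead c3 (route `LiebTwin`; the `EnslavedA1g` copy of the crux is `Iff.rfl`-equal), serving
`--supports stmt-HubbardSuperconductivity-0933` (registered helper stub `stub_localReducedBCSOfCrux`). For the sector
energy gain of Shastry's pencil, `G_L(g) := E_K(H_U) − E_K(H_U − (g/L²)·P_sᴴP_s)`, `K = szSector N_L 0`,
`N_L = 2⌊(1−δ)L²/2⌋`, the line's registered core stub `stub_reducedBCSStability` (RBS) asks `G_L(g) ≤ εL²`
eventually for ONE FIXED `g > 0`. This file proves that the crux `NoOnsiteODLRO` is EQUIVALENT to the same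
inequality with `g = g_L > 0` allowed to depend on `L` ("local RBS"):

* `noOnsiteODLRO_of_localReducedBCS` — local RBS ⇒ the crux (the landed on-site secant
  `Theorems.NoOnsiteODLRO.ReducedChannel.smul_re_expect_le_minEnergyOn_sub` at `c = g_L/L²`: `(g_L/L²)·S_L ≤
  G_L(g_L) ≤ ε g_L L²`);
* `localReducedBCS_of_noOnsiteODLRO` — the crux ⇒ local RBS: the tree's selection lemma
  `Theorems.eventually_uniform_of_noOnsiteODLRO` makes the crux uniform over ground states (`S ≤ (ε/2)L⁴` for
  EVERY unit sector ground state, eventually), and Danskin's first-order gain bound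
  `Theorems.NoOnsiteODLRO.Danskin.pencilGainFirstOrder` (wave 1 of this line, p159261; right derivative of the
  concave pencil energy `= −max_GS S`) then gives `c₀ = c₀(L) > 0` with `G ≤ c·εL⁴` for `0 < c ≤ c₀`; take
  `g_L := c₀ L²`;
* `noOnsiteODLRO_iff_localReducedBCS` — the equivalence; `localReducedBCS_of_reducedBCSStability` — RBS is the
  special case `g_L ≡ g`.

So, kernel-checked: RBS = crux + "the reduced `s`-wave channel has an `L`-UNIFORM stability threshold" — the
quantifier swap `∃ g ∀ L` versus `∀ L ∃ g_L` is the ENTIRE surplus of the line's open stub over the crux (and by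
`Theorems.NoOnsiteODLRO.ReducedBCS.reducedBCSStability_forces_perturbed_noOnsiteODLRO`, p159834, that surplus is
exactly "the crux for the `s`-wave-attracted models `H_U − (g'/L²)P_sᴴP_s`, `g' < g`").
Sources: B. S. Shastry, J. Phys. A 30 (1997) L635, eq. (1); J. M. Danskin, *The Theory of Max-Min* (1967) Ch. I;
T. Kato, *Perturbation Theory for Linear Operators* (1966) II §6.1; R. B. Griffiths, J. Math. Phys. 5 (1964)
1215, §III. Folklore bookkeeping on tree definitions; no definition, no named fact.
-/

noncomputable section

set_option linter.dupNamespace false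

namespace Summit.HubbardSuperconductivity.HubbardSuperconductivity.Theorems.NoOnsiteODLRO.ReducedBCS

open Matrix Finset
open Literature.Probability.LatticeModels Literature.MathematicalPhysics.QuantumLattice
open Literature.Barriers.HubbardSuperconductivity (exists_unit_isGroundStateInSector_hubbardTorus natFloor_filling_le_sq)
open Summit.HubbardSuperconductivity.HubbardSuperconductivity.Theses.LiebTwin (NoOnsiteODLRO)
open Summit.HubbardSuperconductivity.HubbardSuperconductivity.Theorems (eventually_uniform_of_noOnsiteODLRO)
open Summit.HubbardSuperconductivity.HubbardSuperconductivity.Theorems.NoOnsiteODLRO.ReducedChannel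
  (smul_re_expect_le_minEnergyOn_sub)
open Summit.HubbardSuperconductivity.HubbardSuperconductivity.Theorems.NoOnsiteODLRO.Danskin (pencilGainFirstOrder)
open Summit.HubbardSuperconductivity.HubbardSuperconductivity.Theorems.FunctionFieldCertificate
  (mulVec_eq_smul_of_re_rayleigh_eq_minEnergyOn)
open scoped ComplexOrder

/-! ### Local RBS ⇒ the crux -/

/-- **Local reduced-BCS stability implies the crux.** If for all `U > 0`, `δ ∈ (0,1/2)`, `ε > 0`, eventually in
even `L`, SOME `g_L > 0` has `E_K(H_U) − E_K(H_U − (g_L/L²)·P_sᴴP_s) ≤ ε·g_L·L²` (`K = szSector N_L 0`), then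
`NoOnsiteODLRO` holds: the on-site secant at `c = g_L/L²` gives `(g_L/L²)·S_L ≤ ε g_L L²` for every normalised
sector ground state. Shastry (1997) eq. (1); Griffiths (1964) §III. [folklore] -/
theorem noOnsiteODLRO_of_localReducedBCS
    (hloc : ∀ (U δ : ℝ), 0 < U → δ ∈ Set.Ioo (0 : ℝ) (1 / 2) →
      ∀ ε : ℝ, 0 < ε → ∃ L₀ : ℕ, ∀ (L : ℕ) [NeZero L], Even L → L₀ ≤ L → ∃ g : ℝ, 0 < g ∧
        (hubbardTorus 2 L 1 U).minEnergyOn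
              (szSector (Λ := FermionTorus 2 L) (2 * ⌊(1 - δ) * (L : ℝ) ^ 2 / 2⌋₊) 0) -
            (hubbardTorus 2 L 1 U -
                ((g / (L : ℝ) ^ 2 : ℝ) : ℂ) • ((pairField sWave L)ᴴ * pairField sWave L)).minEnergyOn
              (szSector (Λ := FermionTorus 2 L) (2 * ⌊(1 - δ) * (L : ℝ) ^ 2 / 2⌋₊) 0) ≤
          ε * g * (L : ℝ) ^ 2) :
    NoOnsiteODLRO := by
  intro U δ hU hδ N ψ hyp ε hε
  obtain ⟨L₀, hL₀⟩ := hloc U δ hU hδ ε hε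
  refine ⟨L₀, fun L _ hEv hL => ?_⟩
  obtain ⟨hN, hψ1, hmem, -, heig⟩ := hyp L hEv
  obtain ⟨g, hg, hgain⟩ := hL₀ L hEv hL
  rw [← hN] at hgain
  have hH : (hubbardTorus 2 L 1 U).IsHermitian := LiebThm1.hamiltonian_isHermitian (fermionTorusGraph 2 L) 1 U
  have hground : (star (ψ L) ⬝ᵥ (hubbardTorus 2 L 1 U) *ᵥ (ψ L)).re =
      (hubbardTorus 2 L 1 U).minEnergyOn (szSector (Λ := FermionTorus 2 L) (N L) 0) := by
    rw [heig, dotProduct_smul, hψ1, smul_eq_mul, mul_one, Complex.ofReal_re]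
  have hsec := smul_re_expect_le_minEnergyOn_sub hH (pairField sWave L) (g / (L : ℝ) ^ 2)
    (szSector (Λ := FermionTorus 2 L) (N L) 0) hmem hψ1 hground
  have hL1 : (0 : ℝ) < (L : ℝ) := by exact_mod_cast Nat.pos_of_ne_zero (NeZero.ne L)
  have hL2 : (0 : ℝ) < (L : ℝ) ^ 2 := by positivity
  have hL4 : (0 : ℝ) < (L : ℝ) ^ 4 := by positivity
  set S := (star (ψ L) ⬝ᵥ ((pairField sWave L)ᴴ * pairField sWave L) *ᵥ (ψ L)).re with hS
  have key : g / (L : ℝ) ^ 2 * S ≤ ε * g * (L : ℝ) ^ 2 := hsec.trans hgain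
  have key2 : g * S ≤ g * (ε * (L : ℝ) ^ 4) := by
    have h := mul_le_mul_of_nonneg_left key hL2.le
    calc g * S = (L : ℝ) ^ 2 * (g / (L : ℝ) ^ 2 * S) := by field_simp
      _ ≤ (L : ℝ) ^ 2 * (ε * g * (L : ℝ) ^ 2) := h
      _ = g * (ε * (L : ℝ) ^ 4) := by ring
  have hSle : S ≤ ε * (L : ℝ) ^ 4 := le_of_mul_le_mul_left key2 hg
  change S / (L : ℝ) ^ 4 ≤ ε
  rw [div_le_iff₀ hL4]
  exact hSle

/-! ### The crux ⇒ local RBS -/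

/-- **The crux implies local reduced-BCS stability.** If `NoOnsiteODLRO` holds then for all `U > 0`,
`δ ∈ (0,1/2)`, `ε > 0`, eventually in even `L`, there is `g_L > 0` with
`E_K(H_U) − E_K(H_U − (g_L/L²)·P_sᴴP_s) ≤ ε·g_L·L²`. Proof: the crux made uniform over ground states
(`eventually_uniform_of_noOnsiteODLRO` at `ε/2`) bounds `Re⟨φ, P_sᴴP_s φ⟩ ≤ (ε/2)L⁴` for every unit Rayleigh
minimiser `φ` of `H_U` on the sector (a minimiser is a ground eigenvector, `mulVec_eq_smul_of_re_rayleigh_eq_minEnergyOn`,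
the sector being `H_U`-invariant); Danskin's first-order bound `pencilGainFirstOrder` (`M = η = (ε/2)L⁴`) gives
`c₀ > 0` with `E_K(H_U) − E_K(H_U − c·P_sᴴP_s) ≤ c·εL⁴` for `0 < c ≤ c₀`; put `g_L := c₀L²`. Danskin (1967)
Ch. I; Kato (1966) II §6.1. [folklore] -/
theorem localReducedBCS_of_noOnsiteODLRO (hNo : NoOnsiteODLRO) :
    ∀ (U δ : ℝ), 0 < U → δ ∈ Set.Ioo (0 : ℝ) (1 / 2) →
      ∀ ε : ℝ, 0 < ε → ∃ L₀ : ℕ, ∀ (L : ℕ) [NeZero L], Even L → L₀ ≤ L → ∃ g : ℝ, 0 < g ∧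
        (hubbardTorus 2 L 1 U).minEnergyOn
              (szSector (Λ := FermionTorus 2 L) (2 * ⌊(1 - δ) * (L : ℝ) ^ 2 / 2⌋₊) 0) -
            (hubbardTorus 2 L 1 U -
                ((g / (L : ℝ) ^ 2 : ℝ) : ℂ) • ((pairField sWave L)ᴴ * pairField sWave L)).minEnergyOn
              (szSector (Λ := FermionTorus 2 L) (2 * ⌊(1 - δ) * (L : ℝ) ^ 2 / 2⌋₊) 0) ≤
          ε * g * (L : ℝ) ^ 2 := by
  intro U δ hU hδ ε hε
  obtain ⟨L₂, hL₂⟩ := eventually_uniform_of_noOnsiteODLRO hNo hU hδ (half_pos hε)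
  refine ⟨L₂, fun L _ hEv hL => ?_⟩
  set n : ℕ := ⌊(1 - δ) * (L : ℝ) ^ 2 / 2⌋₊ with hn
  set K := szSector (Λ := FermionTorus 2 L) (2 * n) 0 with hK
  set H := hubbardTorus 2 L 1 U with hHdef
  set P := pairField sWave L with hP
  have hH : H.IsHermitian := LiebThm1.hamiltonian_isHermitian (fermionTorusGraph 2 L) 1 U
  have hL1 : (0 : ℝ) < (L : ℝ) := by exact_mod_cast Nat.pos_of_ne_zero (NeZero.ne L)
  have hL2 : (0 : ℝ) < (L : ℝ) ^ 2 := by positivity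
  have hL4 : (0 : ℝ) < (L : ℝ) ^ 4 := by positivity
  -- the sector is nonempty
  have hnL : n ≤ L ^ 2 := natFloor_filling_le_sq (by linarith [hδ.1]) L
  have hKne : K ≠ ⊥ := by
    obtain ⟨φ, hφ1, hφmem, hφne, -⟩ := exists_unit_isGroundStateInSector_hubbardTorus U L n hnL
    intro hbot
    have hφK : φ ∈ K := hφmem
    rw [hbot, Submodule.mem_bot] at hφK
    exact hφne hφK
  -- every unit Rayleigh minimiser on the sector is a ground state, hence has `S ≤ (ε/2) L⁴`
  have hground : ∀ φ ∈ K, star φ ⬝ᵥ φ = 1 → (star φ ⬝ᵥ H *ᵥ φ).re = H.minEnergyOn K →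
      (star φ ⬝ᵥ (Pᴴ * P) *ᵥ φ).re ≤ ε / 2 * (L : ℝ) ^ 4 := by
    intro φ hφK hφ1 hmin
    have hHK : ∀ v ∈ K, H *ᵥ v ∈ K := fun v hv => hubbardTorus_mulVec_mem_szSector 1 U hv
    have heig := mulVec_eq_smul_of_re_rayleigh_eq_minEnergyOn hH K hHK hφK hφ1 hmin
    have hne : φ ≠ 0 := by
      intro h0
      rw [h0, dotProduct_zero] at hφ1
      exact zero_ne_one hφ1
    have hGS : IsGroundStateInSector H (2 * n) 0 φ := ⟨hφK, hne, heig⟩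
    have h := hL₂ L hEv hL φ hφ1 hGS
    rw [div_le_iff₀ hL4] at h
    exact h
  -- Danskin's first-order gain bound with `M = η = (ε/2) L⁴`
  obtain ⟨c₀, hc₀, hc⟩ := pencilGainFirstOrder H (Pᴴ * P) hKne (half_pos (mul_pos hε hL4) :
    (0 : ℝ) < ε * (L : ℝ) ^ 4 / 2) (M := ε / 2 * (L : ℝ) ^ 4) hground
  refine ⟨c₀ * (L : ℝ) ^ 2, by positivity, ?_⟩
  have hcoef : c₀ * (L : ℝ) ^ 2 / (L : ℝ) ^ 2 = c₀ := by field_simp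
  rw [hcoef]
  have h := hc c₀ hc₀ le_rfl
  calc H.minEnergyOn K - (H - (c₀ : ℂ) • (Pᴴ * P)).minEnergyOn K
      ≤ c₀ * (ε / 2 * (L : ℝ) ^ 4 + ε * (L : ℝ) ^ 4 / 2) := h
    _ = ε * (c₀ * (L : ℝ) ^ 2) * (L : ℝ) ^ 2 := by ring

/-! ### The equivalence, and the registered core stub as a special case -/

/-- **Calibration of line `Sketch`.** `NoOnsiteODLRO` is EQUIVALENT to local reduced-BCS stability (the core
stub's inequality with an `L`-dependent channel strength `g_L > 0`). Hence the registered core stub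
`stub_reducedBCSStability` (one FIXED `g`) exceeds the crux exactly by the uniformity of `g` in `L`.
Shastry (1997) eq. (1); Danskin (1967) Ch. I. [folklore] -/
theorem noOnsiteODLRO_iff_localReducedBCS :
    NoOnsiteODLRO ↔
      ∀ (U δ : ℝ), 0 < U → δ ∈ Set.Ioo (0 : ℝ) (1 / 2) →
        ∀ ε : ℝ, 0 < ε → ∃ L₀ : ℕ, ∀ (L : ℕ) [NeZero L], Even L → L₀ ≤ L → ∃ g : ℝ, 0 < g ∧
          (hubbardTorus 2 L 1 U).minEnergyOn
                (szSector (Λ := FermionTorus 2 L) (2 * ⌊(1 - δ) * (L : ℝ) ^ 2 / 2⌋₊) 0) -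
              (hubbardTorus 2 L 1 U -
                  ((g / (L : ℝ) ^ 2 : ℝ) : ℂ) • ((pairField sWave L)ᴴ * pairField sWave L)).minEnergyOn
                (szSector (Λ := FermionTorus 2 L) (2 * ⌊(1 - δ) * (L : ℝ) ^ 2 / 2⌋₊) 0) ≤
            ε * g * (L : ℝ) ^ 2 :=
  ⟨localReducedBCS_of_noOnsiteODLRO, noOnsiteODLRO_of_localReducedBCS⟩

/-- **The core stub is the uniform case**: `stub_reducedBCSStability` (verbatim, as hypothesis) implies local
reduced-BCS stability with the constant channel strength `g_L ≡ g` (tolerance `ε·g`). [folklore] -/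
theorem localReducedBCS_of_reducedBCSStability
    (hRBS : ∀ (U δ : ℝ), 0 < U → δ ∈ Set.Ioo (0 : ℝ) (1 / 2) →
      ∃ g : ℝ, 0 < g ∧ ∀ ε : ℝ, 0 < ε → ∃ L₀ : ℕ, ∀ (L : ℕ) [NeZero L], Even L → L₀ ≤ L →
        (hubbardTorus 2 L 1 U).minEnergyOn
              (szSector (Λ := FermionTorus 2 L) (2 * ⌊(1 - δ) * (L : ℝ) ^ 2 / 2⌋₊) 0) -
            (hubbardTorus 2 L 1 U -
                ((g / (L : ℝ) ^ 2 : ℝ) : ℂ) • ((pairField sWave L)ᴴ * pairField sWave L)).minEnergyOn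
              (szSector (Λ := FermionTorus 2 L) (2 * ⌊(1 - δ) * (L : ℝ) ^ 2 / 2⌋₊) 0) ≤
          ε * (L : ℝ) ^ 2) :
    ∀ (U δ : ℝ), 0 < U → δ ∈ Set.Ioo (0 : ℝ) (1 / 2) →
      ∀ ε : ℝ, 0 < ε → ∃ L₀ : ℕ, ∀ (L : ℕ) [NeZero L], Even L → L₀ ≤ L → ∃ g : ℝ, 0 < g ∧
        (hubbardTorus 2 L 1 U).minEnergyOn
              (szSector (Λ := FermionTorus 2 L) (2 * ⌊(1 - δ) * (L : ℝ) ^ 2 / 2⌋₊) 0) -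
            (hubbardTorus 2 L 1 U -
                ((g / (L : ℝ) ^ 2 : ℝ) : ℂ) • ((pairField sWave L)ᴴ * pairField sWave L)).minEnergyOn
              (szSector (Λ := FermionTorus 2 L) (2 * ⌊(1 - δ) * (L : ℝ) ^ 2 / 2⌋₊) 0) ≤
          ε * g * (L : ℝ) ^ 2 := by
  intro U δ hU hδ ε hε
  obtain ⟨g, hg, hG⟩ := hRBS U δ hU hδ
  obtain ⟨L₀, hL₀⟩ := hG (ε * g) (mul_pos hε hg)
  exact ⟨L₀, fun L _ hEv hL => ⟨g, hg, hL₀ L hEv hL⟩⟩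

/-! ### Registered helper stub -/

/-- **Registered helper stub `stub_localReducedBCSOfCrux`** of crux `NoOnsiteODLRO` (stmt-HubbardSuperconductivity-0933,
line `Sketch`; NOT a composition piece): the crux implies LOCAL reduced-BCS stability (`localReducedBCS_of_noOnsiteODLRO`
with the crux decl spelled out); with `noOnsiteODLRO_of_localReducedBCS` this is the calibration
`noOnsiteODLRO_iff_localReducedBCS`. [folklore] -/
theorem stub_localReducedBCSOfCrux : open Literature.MathematicalPhysics.QuantumLattice Literature.Probability.LatticeModels in Summit.HubbardSuperconductivity.HubbardSuperconductivity.Theses.LiebTwin.NoOnsiteODLRO → ∀ (U δ : ℝ), 0 < U → δ ∈ Set.Ioo (0 : ℝ) (1 / 2) → ∀ ε : ℝ, 0 < ε → ∃ L₀ : ℕ, ∀ (L : ℕ) [NeZero L], Even L → L₀ ≤ L → ∃ g : ℝ, 0 < g ∧ (hubbardTorus 2 L 1 U).minEnergyOn (szSector (Λ := FermionTorus 2 L) (2 * ⌊(1 - δ) * (L : ℝ) ^ 2 / 2⌋₊) 0) - (hubbardTorus 2 L 1 U - ((g / (L : ℝ) ^ 2 : ℝ) : ℂ) • ((pairField sWave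 L)ᴴ * pairField sWave L)).minEnergyOn (szSector (Λ := FermionTorus 2 L) (2 * ⌊(1 - δ) * (L : ℝ) ^ 2 / 2⌋₊) 0) ≤ ε * g * (L : ℝ) ^ 2 :=
  fun h => localReducedBCS_of_noOnsiteODLRO h

end Summit.HubbardSuperconductivity.HubbardSuperconductivity.Theorems.NoOnsiteODLRO.ReducedBCS

end
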